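import Literature.AlgebraicGeometry.Motives.KugaSatakeFunctoriality
import Literature.AlgebraicGeometry.Motives.KugaSatakeHodgeConjecture

/-!
# Route MarkmanPartnerTransport · crux `PicardThreeK3Squares` (stmt-HodgeConjecture-19652) —
# transport of van Geemen's Kuga–Satake data along a similarity of quadratic spaces

Programme «KS-SELF» (a rational Hodge SELF-similitude of the transcendental lattice of a projective K3
surface is algebraic GRANTED the Kuga–Satake statement for the surface, WITHOUT Varesco's theorem as a
named fact), step 2a: pure algebra. A bijective similarity `e : (M₁, q₁) ⥲ (M₂, q₂)` of unit
multiplier `c` (`q₂(e v) = c q₁(v)`) induces Varesco's isomorphism of even Clifford algebras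
`φ = ψ_Cl : C⁺(q₁) ⥲ C⁺(q₂)`, `v w ↦ c⁻¹ (e v)(e w)` (the tree's `KugaSatake.evenEquivOfSimilar`,
Varesco 2023 Lemma 3.2). This file proves that `φ` carries ALL of van Geemen's auxiliary Kuga–Satake
data (§5.7–§6.3 of van Geemen 2000) of `q₁` to those of `q₂`:

* `evenReverse_evenEquivOfSimilar` — `φ` commutes with the anti-involution `ι` (`x ↦ x*`);
* `traceLeft_evenEquivOfSimilar` — `Tr(φ x) = Tr(x)` (trace of left multiplication, conjugation
  invariance);
* `traceForm_evenEquivOfSimilar` — `E_{φ α}(φ x, φ y) = E_α(x, y)` for van Geemen's trace forms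
  `E_α(x, y) = Tr(α ι(x) y)`;
* `coe_evenEquivOfSimilar_embedding` / `embedding_evenEquivOfSimilar` — the sandwich embeddings
  `M_v = [x ↦ v x v₀]` correspond: `M^{q₂}_{e v, c⁻¹ e v₀} ∘ φ = φ ∘ M^{q₁}_{v, v₀}`;
* `isTensorEmbedding_evenEquivOfSimilar` — **van Geemen's tensor inclusion transports**: if `κ` is the
  inclusion `M₁ ↪ C⁺(q₁) ⊗ C⁺(q₁)` for `(E_α, v₀)` then `(φ ⊗ φ) ∘ κ ∘ e⁻¹` is the inclusion
  `M₂ ↪ C⁺(q₂) ⊗ C⁺(q₂)` for `(E_{φ α}, c⁻¹ e v₀)` (`KugaSatake.IsTensorEmbedding`);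
* `ι_bilin_smul_eq_evenEquivOfSimilar` — `(c⁻¹ e e₁)(e e₂) = φ(e₁ e₂)`: the element `α` defining the
  trace form transports to the element of the same shape;
* `map_kugaSatake_F_evenEquivOfSimilar` — for two polarizations `P`, `P' = c P`-on-squares of ONE
  weight-two Hodge structure with `h^{2,0} = 1`, `φ` (for `e = id`) carries the Kuga–Satake Hodge
  filtration of `(H, P)` onto that of `(H, P')` (Varesco Lemma 3.3 = the tree's `kugaSatakeMap`, both ways).

Used (sequel) with `e = id`, `q₂ = d · q₁`: the Kuga–Satake data of the presentation `(T, d·P)` of the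
transcendental part of a K3 surface are the `φ`-transports of those of `(T, P)`, so the two outputs of
the Kuga–Satake predicate have the SAME Kuga–Satake class map. Pure algebra over a commutative ring;
no definition, no named fact, no sorry; credits nothing to the Hodge conjecture. Prover seat
hodge-nonav-19652-p1 (gen 14), `--supports stmt-HodgeConjecture-19652`.

References: M. Varesco, *Hodge similarities, algebraic classes, and Kuga–Satake varieties*, Math. Z.
305 (2023), Lemma 3.2, Lemma 3.3, Prop. 3.1; B. van Geemen, *Kuga-Satake varieties and the Hodge
conjecture* (2000), §5.7, Prop. 5.9, §6.3; M.-A. Knus et al., *The Book of Involutions*, §8 (the even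
Clifford algebra is an invariant of quadratic forms up to similarity).
-/

set_option linter.dupNamespace false

noncomputable section

namespace Summit.HodgeConjecture.HodgeConjecture.Theorems.MarkmanPartnerTransport.KugaSatakeSelf

open scoped TensorProduct
open Literature.AlgebraicGeometry.Motives Literature.AlgebraicGeometry.Motives.HodgeStructure
open Literature.AlgebraicGeometry.Motives.HodgeStructure.KugaSatake

section Ring

variable {R : Type*} [CommRing R]
variable {M₁ M₂ : Type*} [AddCommGroup M₁] [Module R M₁] [AddCommGroup M₂] [Module R M₂]
variable (q₁ : QuadraticForm R M₁) (q₂ : QuadraticForm R M₂)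
variable (e : M₁ ≃ₗ[R] M₂) (c : Rˣ) (he : ∀ v, q₂ (e v) = (c : R) * q₁ v)

/-! ### §1 `φ` commutes with the anti-involution -/

/-- The generator `v w` of `C⁺(q)` as an element of `C(q)` (any commutative ring). [folklore] -/
theorem coe_ι_bilin {M : Type*} [AddCommGroup M] [Module R M] (q : QuadraticForm R M) (v w : M) :
    ((CliffordAlgebra.even.ι q).bilin v w : CliffordAlgebra q) = CliffordAlgebra.ι q v * CliffordAlgebra.ι q w :=
  rfl

/-- **`φ(x*) = φ(x)*`**: the isomorphism `ψ_Cl` of a similarity commutes with the canonical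
anti-involution (both `φ ∘ *` and `* ∘ φ` are anti-homomorphisms `C⁺(q₁) → C⁺(q₂)` agreeing on the
generators `v w`: `(c⁻¹ (e v)(e w))* = c⁻¹ (e w)(e v) = φ((v w)*)`). [cite: Varesco2023, Lemma 3.2]
[cite: vanGeemen2000KugaSatakeHC, §5.7] -/
theorem evenReverse_evenEquivOfSimilar (x : CliffordAlgebra.even q₁) :
    evenReverse q₂ (evenEquivOfSimilar q₁ q₂ e c he x) =
      evenEquivOfSimilar q₁ q₂ e c he (evenReverse q₁ x) := by
  -- the anti-involutions as algebra maps to the opposite algebras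
  let r₁ : CliffordAlgebra.even q₁ →ₐ[R] (CliffordAlgebra.even q₁)ᵐᵒᵖ :=
    { toFun := fun y => MulOpposite.op (evenReverse q₁ y)
      map_one' := by rw [evenReverse_one, MulOpposite.op_one]
      map_mul' := fun y z => by rw [evenReverse_mul, MulOpposite.op_mul]
      map_zero' := by rw [map_zero, MulOpposite.op_zero]
      map_add' := fun y z => by rw [map_add, MulOpposite.op_add]
      commutes' := fun r => by
        rw [MulOpposite.algebraMap_apply]
        congr 1
        ext
        rw [coe_evenReverse, Subalgebra.coe_algebraMap, CliffordAlgebra.reverse.commutes] }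
  let r₂ : CliffordAlgebra.even q₂ →ₐ[R] (CliffordAlgebra.even q₂)ᵐᵒᵖ :=
    { toFun := fun y => MulOpposite.op (evenReverse q₂ y)
      map_one' := by rw [evenReverse_one, MulOpposite.op_one]
      map_mul' := fun y z => by rw [evenReverse_mul, MulOpposite.op_mul]
      map_zero' := by rw [map_zero, MulOpposite.op_zero]
      map_add' := fun y z => by rw [map_add, MulOpposite.op_add]
      commutes' := fun r => by
        rw [MulOpposite.algebraMap_apply]
        congr 1
        ext
        rw [coe_evenReverse, Subalgebra.coe_algebraMap, CliffordAlgebra.reverse.commutes] }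
  have hr₁ : ∀ y, r₁ y = MulOpposite.op (evenReverse q₁ y) := fun _ => rfl
  have hr₂ : ∀ y, r₂ y = MulOpposite.op (evenReverse q₂ y) := fun _ => rfl
  set φ : CliffordAlgebra.even q₁ →ₐ[R] CliffordAlgebra.even q₂ :=
    (evenEquivOfSimilar q₁ q₂ e c he : CliffordAlgebra.even q₁ →ₐ[R] CliffordAlgebra.even q₂) with hφ
  have key : r₂.comp φ = (AlgHom.op φ).comp r₁ := by
    refine CliffordAlgebra.even.algHom_ext _ ?_
    ext m₁ m₂
    simp only [CliffordAlgebra.EvenHom.compr₂_bilin, LinearMap.compr₂_apply, AlgHom.toLinearMap_apply,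
      AlgHom.coe_comp, Function.comp_apply, hr₁, hr₂, AlgHom.op_apply_apply, hφ,
      MulOpposite.unop_op, coe_evenEquivOfSimilar, evenMapOfSimilar_ι_bilin, map_smul, evenReverse_ι_bilin,
      LinearEquiv.coe_coe, MulOpposite.op_smul]
  have h := congrArg (fun f : CliffordAlgebra.even q₁ →ₐ[R] (CliffordAlgebra.even q₂)ᵐᵒᵖ =>
    MulOpposite.unop (f x)) key
  simp only [AlgHom.coe_comp, Function.comp_apply, hr₁, hr₂, AlgHom.op_apply_apply,
    MulOpposite.unop_op, hφ] at h
  exact h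

/-! ### §2 `φ` preserves van Geemen's trace and trace forms -/

/-- **`Tr(φ x) = Tr(x)`**: left multiplication by `φ x` on `C⁺(q₂)` is conjugate under `φ` to left
multiplication by `x` on `C⁺(q₁)`, and the trace is conjugation invariant.
[cite: vanGeemen2000KugaSatakeHC, §5.7] [cite: Varesco2023, Lemma 3.2] -/
theorem traceLeft_evenEquivOfSimilar (x : CliffordAlgebra.even q₁) :
    traceLeft q₂ (evenEquivOfSimilar q₁ q₂ e c he x) = traceLeft q₁ x := by
  set φ := evenEquivOfSimilar q₁ q₂ e c he with hφ
  have hconj : LinearMap.mulLeft R (φ x) = φ.toLinearEquiv.conj (LinearMap.mulLeft R x) := by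
    refine LinearMap.ext fun y => ?_
    rw [LinearEquiv.conj_apply_apply, LinearMap.mulLeft_apply, LinearMap.mulLeft_apply,
      AlgEquiv.toLinearEquiv_apply, map_mul]
    change φ x * y = φ x * φ.toLinearEquiv (φ.toLinearEquiv.symm y)
    rw [LinearEquiv.apply_symm_apply]
  rw [traceLeft_apply, traceLeft_apply, hconj, LinearMap.trace_conj']

/-- **`E_{φ α}(φ x, φ y) = E_α(x, y)`** for van Geemen's trace forms `E_α(x, y) = Tr(α x* y)`.
[cite: vanGeemen2000KugaSatakeHC, Prop. 5.9] [cite: Varesco2023, Lemma 3.2] -/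
theorem traceForm_evenEquivOfSimilar (α x y : CliffordAlgebra.even q₁) :
    traceForm q₂ (evenEquivOfSimilar q₁ q₂ e c he α) (evenEquivOfSimilar q₁ q₂ e c he x)
        (evenEquivOfSimilar q₁ q₂ e c he y) = traceForm q₁ α x y := by
  rw [traceForm_apply, traceForm_apply, evenReverse_evenEquivOfSimilar, ← map_mul, ← map_mul,
    traceLeft_evenEquivOfSimilar]

/-- The same as an identity of bilinear forms: `E_{φ α} ∘ (φ × φ) = E_α`. [cite: vanGeemen2000KugaSatakeHC, Prop. 5.9] -/
theorem traceForm_compl₁₂_evenEquivOfSimilar (α : CliffordAlgebra.even q₁) :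
    (traceForm q₂ (evenEquivOfSimilar q₁ q₂ e c he α)).compl₁₂
        (evenEquivOfSimilar q₁ q₂ e c he).toLinearEquiv.toLinearMap
        (evenEquivOfSimilar q₁ q₂ e c he).toLinearEquiv.toLinearMap = traceForm q₁ α := by
  refine LinearMap.ext fun x => LinearMap.ext fun y => ?_
  rw [LinearMap.compl₁₂_apply]
  exact traceForm_evenEquivOfSimilar q₁ q₂ e c he α x y

/-! ### §3 `φ` and the sandwich embeddings `M_v = [x ↦ v x v₀]` -/

/-- **`(e v) · φ(x) · (e v₀) = c · φ(v · x · v₀)`** in `C(q₂)` for `x ∈ C⁺(q₁)` (induction over the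
even Clifford algebra: for `x = a b y`, `(e v)(c⁻¹ (e a)(e b)) φ(y) (e v₀) = c⁻¹ · c φ(v a) · c φ(b y v₀)`).
[cite: vanGeemen2000KugaSatakeHC, §6.3] [cite: Varesco2023, Lemma 3.2] -/
theorem coe_evenEquivOfSimilar_embedding (v₀ v : M₁) (x : CliffordAlgebra.even q₁) :
    CliffordAlgebra.ι q₂ (e v) * (evenEquivOfSimilar q₁ q₂ e c he x : CliffordAlgebra q₂) *
        CliffordAlgebra.ι q₂ (e v₀) =
      (c : R) • (evenEquivOfSimilar q₁ q₂ e c he (embedding q₁ v₀ v x) : CliffordAlgebra q₂) := by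
  set φ := evenEquivOfSimilar q₁ q₂ e c he with hφ
  -- generators: `φ(a b) = c⁻¹ (e a)(e b)` on underlying elements
  have hgen : ∀ a b : M₁, (φ ((CliffordAlgebra.even.ι q₁).bilin a b) : CliffordAlgebra q₂) =
        ((c⁻¹ : Rˣ) : R) • (CliffordAlgebra.ι q₂ (e a) * CliffordAlgebra.ι q₂ (e b)) := by
    intro a b
    have h : φ ((CliffordAlgebra.even.ι q₁).bilin a b) =
        ((c⁻¹ : Rˣ) : R) • (CliffordAlgebra.even.ι q₂).bilin (e a) (e b) :=
      evenMapOfSimilar_ι_bilin q₁ q₂ e.toLinearMap c he a b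
    rw [h, Subalgebra.coe_smul, coe_ι_bilin]
  obtain ⟨x, hx⟩ := x
  revert v
  induction x, hx using CliffordAlgebra.even_induction with
  | algebraMap r =>
    intro v
    have h1 : (⟨algebraMap R (CliffordAlgebra q₁) r, SetLike.algebraMap_mem_graded _ _⟩ :
        CliffordAlgebra.even q₁) = algebraMap R (CliffordAlgebra.even q₁) r := by ext; rfl
    have h2 : embedding q₁ v₀ v (algebraMap R (CliffordAlgebra.even q₁) r) =
        r • (CliffordAlgebra.even.ι q₁).bilin v v₀ := by
      ext
      rw [coe_embedding_apply, Subalgebra.coe_algebraMap, Subalgebra.coe_smul, coe_ι_bilin,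
        Algebra.algebraMap_eq_smul_one, mul_smul_comm, smul_mul_assoc, mul_one]
    rw [h1, h2, AlgEquiv.commutes, map_smul, Subalgebra.coe_algebraMap, Subalgebra.coe_smul, hgen,
      Algebra.algebraMap_eq_smul_one, mul_smul_comm, smul_mul_assoc, mul_one, smul_smul, smul_smul]
    congr 1
    rw [mul_right_comm, Units.mul_inv, one_mul]
  | add x y hx hy ihx ihy =>
    intro v
    have h1 : (⟨x + y, Submodule.add_mem _ hx hy⟩ : CliffordAlgebra.even q₁) = ⟨x, hx⟩ + ⟨y, hy⟩ := rfl
    rw [h1, map_add, map_add, map_add, Subalgebra.coe_add, Subalgebra.coe_add, mul_add, add_mul, smul_add,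
      ihx v, ihy v]
  | ι_mul_ι_mul a b x hx ih =>
    intro v
    -- `⟨a b x⟩ = (a b) * ⟨x⟩` in `C⁺(q₁)`
    have h1 : (⟨CliffordAlgebra.ι q₁ a * CliffordAlgebra.ι q₁ b * x, _⟩ : CliffordAlgebra.even q₁) =
        (CliffordAlgebra.even.ι q₁).bilin a b * ⟨x, hx⟩ := Subtype.ext rfl
    -- `embedding v₀ v (a b x) = (v a) * embedding v₀ b x`
    have h2 : embedding q₁ v₀ v ((CliffordAlgebra.even.ι q₁).bilin a b * ⟨x, hx⟩) =
        (CliffordAlgebra.even.ι q₁).bilin v a * embedding q₁ v₀ b ⟨x, hx⟩ := by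
      ext
      simp only [coe_embedding_apply, Subalgebra.coe_mul, coe_ι_bilin, mul_assoc]
    rw [h1, h2, map_mul, Subalgebra.coe_mul, hgen, map_mul, Subalgebra.coe_mul, hgen]
    have h3 := ih b
    calc CliffordAlgebra.ι q₂ (e v) * (((c⁻¹ : Rˣ) : R) • (CliffordAlgebra.ι q₂ (e a) * CliffordAlgebra.ι q₂ (e b)) *
            (φ ⟨x, hx⟩ : CliffordAlgebra q₂)) * CliffordAlgebra.ι q₂ (e v₀)
        = ((c⁻¹ : Rˣ) : R) • ((CliffordAlgebra.ι q₂ (e v) * CliffordAlgebra.ι q₂ (e a)) *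
            (CliffordAlgebra.ι q₂ (e b) * (φ ⟨x, hx⟩ : CliffordAlgebra q₂) * CliffordAlgebra.ι q₂ (e v₀))) := by
          simp only [smul_mul_assoc, mul_smul_comm, mul_assoc]
      _ = ((c⁻¹ : Rˣ) : R) • ((CliffordAlgebra.ι q₂ (e v) * CliffordAlgebra.ι q₂ (e a)) *
            ((c : R) • (φ (embedding q₁ v₀ b ⟨x, hx⟩) : CliffordAlgebra q₂))) := by rw [h3]
      _ = (c : R) • (((c⁻¹ : Rˣ) : R) • (CliffordAlgebra.ι q₂ (e v) * CliffordAlgebra.ι q₂ (e a)) *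
            (φ (embedding q₁ v₀ b ⟨x, hx⟩) : CliffordAlgebra q₂)) := by
          simp only [smul_mul_assoc, mul_smul_comm, smul_smul, mul_comm]

/-- **`M_{e v, c⁻¹ e v₀} ∘ φ = φ ∘ M_{v, v₀}`**: the sandwich embedding of `q₂` based at `c⁻¹ e v₀`,
evaluated at `e v`, is the `φ`-conjugate of the embedding of `q₁` based at `v₀`, evaluated at `v`.
[cite: vanGeemen2000KugaSatakeHC, §6.3] [cite: Varesco2023, Lemma 3.2] -/
theorem embedding_evenEquivOfSimilar (v₀ v : M₁) (x : CliffordAlgebra.even q₁) :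
    embedding q₂ (((c⁻¹ : Rˣ) : R) • e v₀) (e v) (evenEquivOfSimilar q₁ q₂ e c he x) =
      evenEquivOfSimilar q₁ q₂ e c he (embedding q₁ v₀ v x) := by
  ext
  rw [coe_embedding_apply, map_smul, mul_smul_comm, coe_evenEquivOfSimilar_embedding, smul_smul,
    Units.inv_mul, one_smul]

/-! ### §4 Transport of van Geemen's tensor inclusion -/

/-- `dualTensorHom` after `E ⊗ 1`, transported: for `E₂ ∘ (φ × φ) = E₁`,
`[(E₂ ⊗ 1)((φ ⊗ φ) z)] = φ ∘ [(E₁ ⊗ 1) z] ∘ φ⁻¹`. [folklore] -/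
theorem dualTensorHom_map_evenEquiv (E₁ : LinearMap.BilinForm R (CliffordAlgebra.even q₁))
    (E₂ : LinearMap.BilinForm R (CliffordAlgebra.even q₂))
    (hE : ∀ x y, E₂ (evenEquivOfSimilar q₁ q₂ e c he x) (evenEquivOfSimilar q₁ q₂ e c he y) = E₁ x y)
    (z : CliffordAlgebra.even q₁ ⊗[R] CliffordAlgebra.even q₁) :
    dualTensorHom R _ _ (TensorProduct.map E₂ LinearMap.id
        (TensorProduct.map (evenEquivOfSimilar q₁ q₂ e c he).toLinearEquiv.toLinearMap
          (evenEquivOfSimilar q₁ q₂ e c he).toLinearEquiv.toLinearMap z)) =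
      (evenEquivOfSimilar q₁ q₂ e c he).toLinearEquiv.toLinearMap ∘ₗ
        dualTensorHom R _ _ (TensorProduct.map E₁ LinearMap.id z) ∘ₗ
          (evenEquivOfSimilar q₁ q₂ e c he).symm.toLinearEquiv.toLinearMap := by
  set φ := evenEquivOfSimilar q₁ q₂ e c he with hφ
  induction z using TensorProduct.induction_on with
  | zero => simp
  | tmul a b =>
    refine LinearMap.ext fun y => ?_
    simp only [TensorProduct.map_tmul, LinearMap.id_coe, id_eq, dualTensorHom_apply, LinearMap.coe_comp,
      Function.comp_apply, LinearEquiv.coe_coe, AlgEquiv.toLinearEquiv_apply, map_smul]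
    congr 1
    conv_lhs => rw [← φ.apply_symm_apply y]
    exact hE a (φ.symm y)
  | add z₁ z₂ h₁ h₂ =>
    simp only [map_add, h₁, h₂, LinearMap.comp_add, LinearMap.add_comp]

/-- **van Geemen's tensor inclusion transports along `φ`.** If `κ : M₁ → C⁺(q₁) ⊗ C⁺(q₁)` is the
inclusion for `(E_α, v₀)` (`IsTensorEmbedding`: `(E_α♭ ⊗ 1)(κ v) = M_{v, v₀}`), then
`(φ ⊗ φ) ∘ κ ∘ e⁻¹ : M₂ → C⁺(q₂) ⊗ C⁺(q₂)` is the inclusion for `(E_{φ α}, c⁻¹ e v₀)`.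
[cite: vanGeemen2000KugaSatakeHC, §6.3 and Prop. 5.9] [cite: Varesco2023, Prop. 3.1] -/
theorem isTensorEmbedding_evenEquivOfSimilar (α : CliffordAlgebra.even q₁) (v₀ : M₁)
    {κ : M₁ →ₗ[R] CliffordAlgebra.even q₁ ⊗[R] CliffordAlgebra.even q₁}
    (hκ : IsTensorEmbedding q₁ (traceForm q₁ α) v₀ κ) :
    IsTensorEmbedding q₂ (traceForm q₂ (evenEquivOfSimilar q₁ q₂ e c he α)) (((c⁻¹ : Rˣ) : R) • e v₀)
      (TensorProduct.map (evenEquivOfSimilar q₁ q₂ e c he).toLinearEquiv.toLinearMap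
          (evenEquivOfSimilar q₁ q₂ e c he).toLinearEquiv.toLinearMap ∘ₗ κ ∘ₗ e.symm.toLinearMap) := by
  set φ := evenEquivOfSimilar q₁ q₂ e c he with hφ
  intro w
  obtain ⟨v, rfl⟩ := e.surjective w
  rw [LinearMap.comp_apply, LinearMap.comp_apply, LinearEquiv.coe_toLinearMap, e.symm_apply_apply,
    dualTensorHom_map_evenEquiv q₁ q₂ e c he _ _ (traceForm_evenEquivOfSimilar q₁ q₂ e c he α), hκ v]
  refine LinearMap.ext fun y => ?_
  rw [LinearMap.comp_apply, LinearMap.comp_apply, LinearEquiv.coe_toLinearMap, LinearEquiv.coe_toLinearMap,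
    AlgEquiv.toLinearEquiv_apply, AlgEquiv.toLinearEquiv_apply, ← embedding_evenEquivOfSimilar,
    AlgEquiv.apply_symm_apply]

/-- **`(c⁻¹ e e₁)(e e₂) = φ(e₁ e₂)`**: the product of two vectors defining the trace form transports to
the product of the transported vectors. [cite: vanGeemen2000KugaSatakeHC, Prop. 5.9] -/
theorem ι_bilin_smul_eq_evenEquivOfSimilar (e₁ e₂ : M₁) :
    (CliffordAlgebra.even.ι q₂).bilin (((c⁻¹ : Rˣ) : R) • e e₁) (e e₂) =
      evenEquivOfSimilar q₁ q₂ e c he ((CliffordAlgebra.even.ι q₁).bilin e₁ e₂) := by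
  have h := evenMapOfSimilar_ι_bilin q₁ q₂ e.toLinearMap c he e₁ e₂
  rw [← coe_evenEquivOfSimilar] at h
  rw [LinearMap.map_smul₂]
  exact h.symm

end Ring


/-! ### §5 The Kuga–Satake Hodge filtration under a rescaling of the polarization -/

section Hodge

variable {V : Type*} [AddCommGroup V] [Module ℚ V] {H : HodgeStructure V 2}
variable (P P' : H.Polarization) (hT : H.hodgeNumber 2 0 = 1) (c : ℚˣ)
variable (hc : ∀ v, P'.quadraticForm (LinearEquiv.refl ℚ V v) = (c : ℚ) * P.quadraticForm v)

/-- **Rescaling the polarization does not change the Kuga–Satake Hodge structure**: for two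
polarizations `P`, `P'` of the same weight-two Hodge structure with `P'(v, v) = c P(v, v)`, the
isomorphism `φ : C⁺(Q) ⥲ C⁺(Q')` of the identity similarity carries the Kuga–Satake filtration of
`(H, P)` ONTO that of `(H, P')` (Varesco Lemma 3.3, `HodgeStructure.kugaSatakeMap`, applied to the
identity similarity of multiplier `c` and to its inverse of multiplier `c⁻¹`).
[cite: Varesco2023, Lemma 3.3] [cite: vanGeemen2000KugaSatakeHC, §5.5–5.7] -/
theorem map_kugaSatake_F_evenEquivOfSimilar (p : ℤ) :
    ((kugaSatake H P hT).F p).map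
        ((evenEquivOfSimilar P.quadraticForm P'.quadraticForm (LinearEquiv.refl ℚ V) c hc).toLinearEquiv.toLinearMap.baseChange ℂ) =
      (kugaSatake H P' hT).F p := by
  set φ := evenEquivOfSimilar P.quadraticForm P'.quadraticForm (LinearEquiv.refl ℚ V) c hc with hφ
  have hc' : ∀ v, P.quadraticForm ((LinearEquiv.refl ℚ V).symm v) = ((c⁻¹ : ℚˣ) : ℚ) * P'.quadraticForm v :=
    similar_symm P.quadraticForm P'.quadraticForm (LinearEquiv.refl ℚ V) c hc
  -- the two directions, from the morphisms of Kuga–Satake Hodge structures of `id` and `id⁻¹`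
  have h₁ := (kugaSatakeMap P P' hT hT (Hom.id H) c hc).map_F_le p
  have h₂ := (kugaSatakeMap P' P hT hT (Hom.id H) c⁻¹ hc').map_F_le p
  have e₁ : (kugaSatakeMap P P' hT hT (Hom.id H) c hc).toLinearMap = φ.toLinearEquiv.toLinearMap := rfl
  have e₂ : (kugaSatakeMap P' P hT hT (Hom.id H) c⁻¹ hc').toLinearMap = φ.symm.toLinearEquiv.toLinearMap := rfl
  rw [e₁] at h₁
  rw [e₂] at h₂
  refine le_antisymm h₁ fun y hy => ?_
  refine ⟨φ.symm.toLinearEquiv.toLinearMap.baseChange ℂ y, h₂ ⟨y, hy, rfl⟩, ?_⟩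
  rw [← LinearMap.comp_apply, ← LinearMap.baseChange_comp]
  have hid : φ.toLinearEquiv.toLinearMap ∘ₗ φ.symm.toLinearEquiv.toLinearMap = LinearMap.id :=
    LinearMap.ext fun z => φ.apply_symm_apply z
  rw [hid, LinearMap.baseChange_id, LinearMap.id_apply]

end Hodge

end Summit.HodgeConjecture.HodgeConjecture.Theorems.MarkmanPartnerTransport.KugaSatakeSelf

end
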